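import Summits.QuantumFields.BalabanUV.T4Continuum.Spine.NE3.RemainderSumsStepB8
import Summits.QuantumFields.BalabanUV.T4Continuum.Spine.NE3.RemainderTelescopeB8
import Summits.QuantumFields.BalabanUV.T4Continuum.Spine.NE3.RemainderTowerArith
import Summits.QuantumFields.BalabanUV.T4Continuum.Spine.NE3.RemainderTowerLevelsB8
import Summits.QuantumFields.BalabanUV.T4Continuum.Spine.NE3.RemainderL1TowerB8
import HarnessLib

/-!
# T⁴ programme, node NE3 — census R26′, step 2c-γ: THE QUADRATIC ℓ¹ SIZE OF THE NORMAL DATUM WITHOUT THE Π-REG MAJORANT —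
# `dirL1 (QbarIter L (j+1) W Z) (periodBox N) ≤ 64·C₁L²·d(4L+1)^d·(L^{2−d})^{j}·l2sq Z` (k-free at d = 4: `(L^{2−d})^j = L²·ξ²`)

Cell `pub-balaban-gaps` (YM blitz, track G2, seat `ne3`, unit `pub-balaban-gaps-ne3`; writer prover-pub-balaban-gaps-ne3-g4-0, 2026-08-23), census
`run/shared/lean/pub/pub-balaban-gaps/ne/NE3.md` §4 R26′ ∕ §10 F8.  Inputs BY NAME: the telescoping `RemainderTelescopeB8.linCovIter_sub_logCovIter_eq_sum`, the ℓ¹ tower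
`RemainderL1TowerB8.dirL1_QbarIter_le` (under its displayed level-sum line), the QUADRATIC one-step remainder in ℓ¹ `RemainderSumsStepB8.sum_norm_Ccov_le` (no sup factor), the level
sizes `RemainderTowerLevelsB8.sqrt_l2sq_logCovIter_le`, the dictionary `QbarTowerB8.linCovIter_adField`.  This is the second of the two sizes of `φ = QbarIter L (j+1) W Z` that the
supplier's `preSizes` reads off the Π-REG majorant (the first, `dirSq φ`, is `RemainderTowerB8.sqrt_l2sq_QbarIter_le`); with both in hand the supplier can be re-wired WITHOUT Π-REG (step 2d,
NOT here).

CONTENT (all [folklore]; 0 sorry; 0 def): `dirL1_adField`, `dirL1_finset_sum_le`, `radSum_mono`, `radSum_radIter_le` (partial level sums are dominated by the full one),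
**`dirL1_QbarIter_le_quadratic`**.

HONEST FRAMING.  Kinematics∕bookkeeping on OUR objects under ONE displayed level-sum line (`K₁·radSum d L j x ≤ (L∕L^d)∕2`, k-free, from the crude box count of the ℓ¹ defect);
NOTHING of Bałaban's is proved beyond printed-type one-step letters' consequences; **NE3 is NOT proved**; spine PROVED 0∕9; finite T⁴ rung (B)+1 — NOT continuum YM on ℝ⁴,
NOT infinite volume, NOT mass gap, NOT `BetaPertH`, NOT Clay.  PLACEMENT: `Summits/QuantumFields/BalabanUV/T4Continuum/Spine/NE3/`.
-/

set_option autoImplicit false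

open scoped BigOperators Matrix.Norms.L2Operator
open NormedSpace Finset

namespace Summit.QuantumFields.BalabanUV.T4Continuum.NE3.RemainderL1FinalB8

open Literature.MathematicalPhysics.QuantumFieldTheory.Balaban1983to89
open B7Prop1Explicit B7Prop2Explicit B7Prop3Flat MatrixLog
open B7Prop3GeneralLinear (Ccov linQcov Qcov)
open B7Prop4GeneralLevels (logCovIter linCovIter)
open B7Eq123General (prop4_general level_data blockLoops_of_pdev dbavgCovIter_eq_expCfg_logCovIter)
open B7Eq92Concrete (dbavgCovIter)
open B12Ineq417Flat (shiftCfg shiftCfg_apply)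
open B7AvgPeriodicity (periodic_of_coord logCovIter_periodic linCovIter_periodic Qcov_periodic)
open T4AveragingDeficitWall (IsSkewDir IsUnitaryCfg SmallField Ad dirSq)
open T4AveragingDeficitWallBoundary (IsPeriodicCfg periodBox)
open AveragingDeficitPeriodicCounting (IsPeriodicDir)
open AveragingDeficitChartCalculus (cavg)
open AveragingDeficitMultiLevelPrep (cavgIter LevelSmall radIter tower cavgIter_unitary_small isPeriodicCfg_cavgIter prop1Radius_nonneg)
open AveragingDeficitTwoLevelPrep (prop1Radius)
open AveragingDeficitMultiLevelBridge (cavgIter_eq_avgIter)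
open AveragingDeficitTransport (norm_Ad_of_unitary)
open AveragingDeficitNearIdentity (Ad_one)
open T4AveragingDeficitNonAbelian (Ad_mul)
open NE3TangentCovariantTower (QbarIter)
open NE3CovariantLineSumsL2 (l2sq l2sq_nonneg sqrt_l2sq_add_le)
open NE3FramePotBoundW (tower_eq_pow_mul levelSmall_of_le)
open NE3FramePotBoundWClass (l2sq_QbarIter_le_class)
open NE3.QbarDictionary (adField)
open NE3.QbarTowerB8 (linCovIter_adField logCovIter_eq_zero_of_dbar)
open NE3.RemainderTowerPrepB8 (shiftCfg_of_isPeriodicCfg shiftCfg_of_isPeriodicDir l2sq_adField levelSmall_radIter)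
open NE3.RemainderTowerLevelsB8 (sqrt_l2sq_logCovIter_le)
open NE3.RemainderL1TowerB8 (dirL1_QbarIter_le dirL1_add_le' dirL1_nonneg')
open NE3.RemainderSumsStepB8 (sum_norm_Ccov_le)
open NE3.RemainderTowerArith (geom_sum_L_le)
open ReplicationRightInverseBound (radSum radSum_nonneg)
open BlockAverageVaryHolo (nbRad)
open NE3CovariantLineSumsError (Csup Csup_nonneg)
open T4AveragingDeficitWall (dirL1)
open NE3.RemainderSumsStepB8 (sum_normSq_Ccov_le)
open NE3.RemainderTelescopeB8 (linCovIter_sub_logCovIter_eq_sum linCovIter_one)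
open NE3.RemainderTowerArith (tower_l2_induction tower_l2_total)
open ShellMeasureAverageProp4General (C1cov C1cov_pos)

noncomputable section

variable {d : ℕ} {n : Type*} [Fintype n] [DecidableEq n]



/-! ## §1 Helpers -/

/-- `dirL1` is invariant under conjugation by a unitary configuration. [folklore] -/
theorem dirL1_adField {V : Site d → Fin d → (Matrix n n ℂ)ˣ} (hV : IsUnitaryCfg V) (F : Finset (Site d)) (Y : Site d → Fin d → Matrix n n ℂ) :
    dirL1 (adField V Y) F = dirL1 Y F := by
  unfold dirL1 adField
  refine Finset.sum_congr rfl fun z _ => Finset.sum_congr rfl fun κ _ => ?_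
  rw [norm_Ad_of_unitary (hV z κ)]

/-- Triangle for `dirL1` over a finite sum of fields. [folklore] -/
theorem dirL1_finset_sum_le {ι : Type*} (s : Finset ι) (F : Finset (Site d)) (f : ι → Site d → Fin d → Matrix n n ℂ) :
    dirL1 (∑ i ∈ s, f i) F ≤ ∑ i ∈ s, dirL1 (f i) F := by
  classical
  induction s using Finset.induction_on with
  | empty =>
      simp only [Finset.sum_empty]
      have : dirL1 (0 : Site d → Fin d → Matrix n n ℂ) F = 0 := by unfold dirL1; simp
      rw [this]
  | insert i s hi ih =>
      rw [Finset.sum_insert hi, Finset.sum_insert hi]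
      have h := dirL1_add_le' (f i) (∑ j ∈ s, f j) F
      have e : (fun z κ => f i z κ + (∑ j ∈ s, f j) z κ) = f i + ∑ j ∈ s, f j := by
        funext z κ; simp [Finset.sum_apply]
      rw [e] at h
      exact h.trans (add_le_add le_rfl ih)

/-- `dirL1 (−f) = dirL1 f`. [folklore] -/
theorem dirL1_neg (F : Finset (Site d)) (f : Site d → Fin d → Matrix n n ℂ) : dirL1 (-f) F = dirL1 f F := by
  unfold dirL1; simp

/-- `radSum` is monotone in the number of levels: `radSum m x ≤ radSum j x` for `m ≤ j`, `x ≥ 0`. [folklore] -/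
theorem radSum_mono {L : ℕ} : ∀ (j m : ℕ) {x : ℝ}, m ≤ j → 0 ≤ x → radSum d L m x ≤ radSum d L j x
  | 0, m, x, hm, _ => by rw [Nat.le_zero.mp hm]
  | j + 1, 0, x, _, hx => by
      show x ≤ x + radSum d L j (prop1Radius d L x)
      have := radSum_nonneg (d := d) (L := L) j (prop1Radius_nonneg (d := d) (L := L) hx)
      linarith
  | j + 1, m + 1, x, hm, hx => by
      show x + radSum d L m (prop1Radius d L x) ≤ x + radSum d L j (prop1Radius d L x)
      have := radSum_mono (L := L) j m (by omega) (prop1Radius_nonneg (d := d) (L := L) hx)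
      linarith

/-- Partial level sums started at an averaged radius are dominated by the full level sum: `radSum m (radIter i x) ≤ radSum j x` for `i + m ≤ j`, `x ≥ 0`. [folklore] -/
theorem radSum_radIter_le {L : ℕ} : ∀ (i : ℕ) (j m : ℕ) {x : ℝ}, i + m ≤ j → 0 ≤ x → radSum d L m (radIter d L i x) ≤ radSum d L j x
  | 0, j, m, x, h, hx => radSum_mono j m (by omega) hx
  | i + 1, j, m, x, h, hx => by
      cases j with
      | zero => omega
      | succ j =>
          show radSum d L m (radIter d L i (prop1Radius d L x)) ≤ x + radSum d L j (prop1Radius d L x)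
          have h1 := radSum_radIter_le (L := L) i j m (by omega) (prop1Radius_nonneg (d := d) (L := L) hx)
          linarith

/-! ## §2 The quadratic ℓ¹ size -/

/-- **THE QUADRATIC ℓ¹ SIZE OF THE NORMAL DATUM WITHOUT Π-REG** (hypotheses of `RemainderTowerB8.sqrt_l2sq_QbarIter_le` plus the ℓ¹ tower's level-sum line):
`dirL1 (QbarIter L (j+1) W Z) (periodBox N) ≤ 64·C₁L²·d(4L+1)^d·((L∕L^d)·L)^j·l2sq (periodBox (N·L^{j+1})) Z` — at `d = 4`, `((L∕L^d)·L)^j = L^{−2j} = L²ξ²`: the input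
`dirL1 φ ≲ M^{2−d}·dirSq Z` of the ℓ¹-curl letter, QUADRATIC in `Z`, with NO regularity of `Z`. [folklore] -/
theorem dirL1_QbarIter_le_quadratic [Nonempty n] {L N : ℕ} (hL : 2 ≤ L) (hN : 1 ≤ N) (j : ℕ)
    {W : Site d → Fin d → (Matrix n n ℂ)ˣ} {x : ℝ} (hWu : IsUnitaryCfg W) (hWP : IsPeriodicCfg W ((N * L ^ (j + 1) : ℕ) : ℤ))
    (hx : 0 ≤ x) (hsm : LevelSmall d L j x) (hWx : SmallField W x)
    {α₀ b : ℝ} (hα : 0 < α₀) (hα3 : C0 d * (2 * α₀) ≤ 1 / 3) (hα4 : 4 * (2 * α₀) ≤ c2' d L)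
    (h52 : pdev W < α₀ * (((L : ℝ) ^ (j + 1))⁻¹) ^ 2) (hb : 0 ≤ b)
    {Z : Site d → Fin d → Matrix n n ℂ} (hZ : ∀ (y : Site d) (κ : Fin d), ‖Z y κ‖ ≤ b) (hZP : IsPeriodicDir Z ((N * L ^ (j + 1) : ℕ) : ℤ))
    (hsmall : Real.exp (4 * (800 * ((d : ℝ) + 1) ^ 2 * ((d : ℝ) + 4)) * α₀)
      * (1 + 8 * (131072 * ((d : ℝ) + 1) ^ 2) * ((L : ℝ) ^ (j + 1) * b)) ≤ 2)
    (hc₃ : 4 * ((L : ℝ) ^ (j + 1) * b) ≤ c3 d L)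
    (hK : 16 * (C1cov d * (L : ℝ) ^ 2 * Real.sqrt (d * (2 * (2 * L) + 1) ^ d)) * (L : ℝ) ^ (j + 1) * b ≤ Real.sqrt ((L : ℝ) ^ 2 / (L : ℝ) ^ d))
    (hS1 : (16 * (d + 1) * (d + 4) * (L : ℝ) ^ 2 * Csup d L * (d * (2 * nbRad d L + 1) ^ d)) * radSum d L j x ≤ ((L : ℝ) / (L : ℝ) ^ d) / 2)
    (hdbar : dbavgCovIter L W (expCfg (adField W Z)) (j + 1) = 1) :
    dirL1 (QbarIter L (j + 1) W Z) (periodBox (d := d) N)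
      ≤ 64 * (C1cov d * (L : ℝ) ^ 2 * (d * (2 * (2 * (L : ℝ)) + 1) ^ d)) * (((L : ℝ) / (L : ℝ) ^ d) * L) ^ (j + 1 - 1)
          * l2sq (periodBox (d := d) (N * L ^ (j + 1))) Z := by
  letI : CStarAlgebra (Matrix n n ℂ) := {}
  have hL1 : 1 ≤ L := by omega
  have hL0 : (0 : ℝ) < L := by exact_mod_cast (show 0 < L by omega)
  have hLR : (2 : ℝ) ≤ L := by exact_mod_cast hL
  set k : ℕ := j + 1 with hk
  -- the fine field `B = Ad_W Z` and the regime data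
  set B : Site d → Fin d → Matrix n n ℂ := adField W Z with hBdef
  have hBsup : ∀ (y : Site d) (κ : Fin d), ‖B y κ‖ ≤ b := fun y κ => by
    rw [hBdef]; unfold adField; rw [norm_Ad_of_unitary (hWu y κ)]; exact hZ y κ
  have hG := avgClosed_unitaryUnits d (𝔸 := Matrix n n ℂ) L
  have hU₀ : ∀ (y : Site d) (κ : Fin d), W y κ ∈ unitaryUnits (Matrix n n ℂ) := hWu
  have hα3' : C0 d * α₀ ≤ 1 / 3 := by
    have hC : 0 ≤ C0 d := by unfold C0; positivity
    nlinarith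
  have hα4' : 4 * α₀ ≤ c2' d L := by linarith
  have hc₃' : 2 * ((L : ℝ) ^ k * b) ≤ c3 d L := by rw [hk]; nlinarith [pow_pos hL0 (j + 1)]
  have h4 := prop4_general L hL hG k W hU₀ hα hα3' hα4' h52 B hb hBsup hsmall hc₃'
  have hld := level_data L hL hG k W hU₀ hα hα3' hα4' h52
  -- loops of every averaged background below the top
  have hloopsW : ∀ i < k, ∀ (z : Site d) (κ : Fin d) (r : Fin d → Fin L),
      ‖((Wcx L (cavgIter L i W) ((L : ℤ) • z) κ (boxVec L r) : (Matrix n n ℂ)ˣ) : Matrix n n ℂ) - 1‖ < 1 := by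
    intro i hi z κ r
    obtain ⟨hV, hβ0, hβ, hβmax⟩ := hld i hi.le
    rw [cavgIter_eq_avgIter]
    have h := blockLoops_of_pdev hL1 hV hβ0 hβ hβmax ((L : ℤ) • z) κ
    exact ((h.1 r).trans h.2).trans_lt (by norm_num)
  -- periodicity bookkeeping: `L^i · (N·L^{k−i}) = N·L^k`
  have hPk : ∀ i ≤ k, L ^ i * (N * L ^ (k - i)) = N * L ^ k := by
    intro i hi
    rw [mul_left_comm, ← pow_add, Nat.add_sub_cancel' hi]
  have hWsh : ∀ a : Site d, shiftCfg (((N * L ^ k : ℕ) : ℤ) • a) W = W := shiftCfg_of_isPeriodicCfg hWP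
  have hBP : IsPeriodicDir B ((N * L ^ k : ℕ) : ℤ) := by
    intro y i μ; rw [hBdef]; unfold adField; rw [hWP y i μ, hZP y i μ]
  have hBsh : ∀ a : Site d, shiftCfg (((N * L ^ k : ℕ) : ℤ) • a) B = B := shiftCfg_of_isPeriodicDir hBP
  -- the nonlinear iterates: sup (Prop. 4) and periodicity
  have hAsup : ∀ i ≤ k, ∀ (y : Site d) (κ : Fin d), ‖logCovIter L W B i y κ‖ ≤ 2 * ((L : ℝ) ^ i * b) :=
    fun i hi => (h4 i hi).2
  have hAP : ∀ i ≤ k, ∀ (y : Site d) (κ μ : Fin d),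
      logCovIter L W B i (y + ((N * L ^ (k - i) : ℕ) : ℤ) • e κ) μ = logCovIter L W B i y μ := by
    intro i hi y κ μ
    have hT : ∀ a : Site d, shiftCfg ((((L : ℤ) ^ i) * ((N * L ^ (k - i) : ℕ) : ℤ)) • a) W = W := by
      intro a
      have e : ((L : ℤ) ^ i) * ((N * L ^ (k - i) : ℕ) : ℤ) = ((N * L ^ k : ℕ) : ℤ) := by
        rw [← hPk i hi]; push_cast; ring
      rw [e]; exact hWsh a
    have hT' : ∀ a : Site d, shiftCfg ((((L : ℤ) ^ i) * ((N * L ^ (k - i) : ℕ) : ℤ)) • a) B = B := by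
      intro a
      have e : ((L : ℤ) ^ i) * ((N * L ^ (k - i) : ℕ) : ℤ) = ((N * L ^ k : ℕ) : ℤ) := by
        rw [← hPk i hi]; push_cast; ring
      rw [e]; exact hBsh a
    exact logCovIter_periodic L W B i hT hT' (e κ) y μ
  -- per-level averaged backgrounds: pointwise periodicity
  have hVP : ∀ i ≤ k, IsPeriodicCfg (cavgIter L i W) ((N * L ^ (k - i) : ℕ) : ℤ) := by
    intro i hi
    refine isPeriodicCfg_cavgIter L (N * L ^ (k - i)) i ?_
    rw [tower_eq_pow_mul, hPk i hi]; exact hWP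
  -- the one-step remainder fields
  set Cf : ℕ → Site d → Fin d → Matrix n n ℂ :=
    fun i z κ => Ccov L (avgIter L W i) (logCovIter L W B i) ((L : ℤ) • z) κ with hCf
  -- periodicity of the one-step remainder fields: `Cf i` is `(N·L^{k−(i+1)})`-periodic for `i < k`
  have hCfP : ∀ i < k, IsPeriodicDir (Cf i) ((N * L ^ (k - (i + 1)) : ℕ) : ℤ) := by
    intro i hi z κ' μ
    have hP1 : L ^ 1 * (N * L ^ (k - (i + 1))) = N * L ^ (k - i) := by
      rw [pow_one, mul_left_comm, ← pow_succ']; congr 2; omega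
    have hVsh : ∀ a : Site d, shiftCfg ((((L : ℤ) ^ 1) * ((N * L ^ (k - (i + 1)) : ℕ) : ℤ)) • a) (avgIter L W i) = avgIter L W i := by
      intro a
      have e : ((L : ℤ) ^ 1) * ((N * L ^ (k - (i + 1)) : ℕ) : ℤ) = ((N * L ^ (k - i) : ℕ) : ℤ) := by
        rw [← hP1]; push_cast; ring
      rw [e, ← cavgIter_eq_avgIter]; exact shiftCfg_of_isPeriodicCfg (hVP i hi.le) a
    have hAsh : ∀ a : Site d, shiftCfg ((((L : ℤ) ^ 1) * ((N * L ^ (k - (i + 1)) : ℕ) : ℤ)) • a) (logCovIter L W B i) = logCovIter L W B i := by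
      intro a
      have e : ((L : ℤ) ^ 1) * ((N * L ^ (k - (i + 1)) : ℕ) : ℤ) = ((N * L ^ (k - i) : ℕ) : ℤ) := by
        rw [← hP1]; push_cast; ring
      rw [e]; exact shiftCfg_of_isPeriodicDir (fun y κ μ => hAP i hi.le y κ μ) a
    -- the remainder is `Q − L(Q·)`; both are periodic
    have hQ : Qcov L (avgIter L W i) (logCovIter L W B i) ((L : ℤ) • (z + ((N * L ^ (k - (i + 1)) : ℕ) : ℤ) • e κ')) μ
        = Qcov L (avgIter L W i) (logCovIter L W B i) ((L : ℤ) • z) μ := by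
      have e1 : (L : ℤ) • (z + ((N * L ^ (k - (i + 1)) : ℕ) : ℤ) • e κ') = (L : ℤ) • z + (((N * L ^ (k - i) : ℕ) : ℤ)) • e κ' := by
        rw [smul_add, smul_smul, ← hP1]; push_cast; ring_nf
      rw [e1]
      refine Qcov_periodic L _ _ ?_ ?_ _ μ
      · rw [← cavgIter_eq_avgIter]
        have := shiftCfg_of_isPeriodicCfg (hVP i hi.le) (e κ')
        exact this
      · exact shiftCfg_of_isPeriodicDir (fun y κ μ => hAP i hi.le y κ μ) (e κ')
    have hLin : linQcov L (avgIter L W i) (logCovIter L W B i) ((L : ℤ) • (z + ((N * L ^ (k - (i + 1)) : ℕ) : ℤ) • e κ')) μ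
        = linQcov L (avgIter L W i) (logCovIter L W B i) ((L : ℤ) • z) μ := by
      rw [← linCovIter_one, ← linCovIter_one]
      exact linCovIter_periodic L (avgIter L W i) (logCovIter L W B i) 1 hVsh hAsh (e κ') z μ
    simp only [hCf, Ccov, hQ, hLin]
  -- the level sizes (step 2b-γ) and the top: `A_k = 0`
  have hlev := sqrt_l2sq_logCovIter_le hL hN j hWu hWP hx hsm hWx hα hα3 hα4 h52 hb hZ hZP hsmall hc₃ hK
  have hQ := dbavgCovIter_eq_expCfg_logCovIter L hL hG k W hU₀ hα hα3' hα4' h52 B hb hBsup hsmall hc₃'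
  have hzero : logCovIter L W B k = fun _ _ => 0 := by
    rw [hk]; exact logCovIter_eq_zero_of_dbar L W B j (hQ j (by omega)) hdbar
  have hidk := linCovIter_sub_logCovIter_eq_sum L hL hG k W hU₀ hα hα3 hα4 h52 B
  have hlin : linCovIter L W B k = -∑ i ∈ Finset.range k, linCovIter L (avgIter L W (i + 1)) (Cf i) (k - (i + 1)) := by
    have h := hidk
    rw [hzero] at h
    have e : linCovIter L W B k - (fun _ _ => (0 : Matrix n n ℂ)) = linCovIter L W B k := by funext z κ; simp
    rw [e] at h
    exact h
  -- per term: the ℓ¹ tower from `Ū₀^{i+1}`, then the quadratic one-step remainder, then the level size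
  set r : ℝ := (L : ℝ) / (L : ℝ) ^ d with hrdef
  set ρ2 : ℝ := (L : ℝ) ^ 2 / (L : ℝ) ^ d with hρ2def
  have hr0' : 0 ≤ r := by rw [hrdef]; positivity
  have hρ20 : 0 ≤ ρ2 := by rw [hρ2def]; positivity
  have hrρ : ρ2 = r * L := by rw [hρ2def, hrdef]; field_simp
  set K1' : ℝ := C1cov d * (L : ℝ) ^ 2 * (d * (2 * (2 * (L : ℝ)) + 1) ^ d) with hK1'
  have hK1'0 : 0 ≤ K1' := by rw [hK1']; have := C1cov_pos d; positivity
  set β2 : ℝ := l2sq (periodBox (d := d) (N * L ^ k)) Z with hβ2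
  have hβ20 : 0 ≤ β2 := l2sq_nonneg _ _
  have hterm : ∀ i ∈ Finset.range k,
      dirL1 (linCovIter L (avgIter L W (i + 1)) (Cf i) (k - (i + 1))) (periodBox (d := d) N) ≤ 32 * K1' * β2 * r ^ (k - 1) * (L : ℝ) ^ i := by
    intro i hi
    have hik : i < k := Finset.mem_range.mp hi
    -- (a) the quadratic ℓ¹ size of `Cf i`
    obtain ⟨hV, hβ0', hβ', hβmax'⟩ := hld i hik.le
    have hN₁ : 1 ≤ N * L ^ (k - (i + 1)) := Nat.one_le_iff_ne_zero.mpr (Nat.mul_ne_zero (by omega) (pow_ne_zero _ (by omega)))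
    have hLN : L * (N * L ^ (k - (i + 1))) = N * L ^ (k - i) := by
      rw [mul_left_comm, ← pow_succ']; congr 2; omega
    have hLi : (L : ℝ) ^ i ≤ (L : ℝ) ^ k := pow_le_pow_right₀ (by linarith) hik.le
    have ha0 : 0 ≤ 2 * ((L : ℝ) ^ i * b) := by positivity
    have hac : 2 * ((L : ℝ) ^ i * b) ≤ c3 d L / 2 := by nlinarith [mul_le_mul_of_nonneg_right hLi hb]
    have hAP' : ∀ (y : Site d) (κ μ : Fin d),
        logCovIter L W B i (y + ((L * (N * L ^ (k - (i + 1))) : ℕ) : ℤ) • e κ) μ = logCovIter L W B i y μ := by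
      rw [hLN]; exact hAP i hik.le
    have hC1 := sum_norm_Ccov_le hL1 hV hβ0' hβ' hβmax' hN₁ (logCovIter L W B i) ha0 (hAsup i hik.le) hac hAP'
    rw [hLN] at hC1
    have hAi := hlev i hik.le
    have hAi2 : l2sq (periodBox (d := d) (N * L ^ (k - i))) (logCovIter L W B i) ≤ (4 * Real.sqrt ρ2 ^ i) ^ 2 * β2 := by
      have h0 : 0 ≤ l2sq (periodBox (d := d) (N * L ^ (k - i))) (logCovIter L W B i) := l2sq_nonneg _ _
      have h1 := pow_le_pow_left₀ (Real.sqrt_nonneg _) hAi 2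
      rw [Real.sq_sqrt h0, mul_pow, Real.sq_sqrt hβ20] at h1
      rw [hBdef] at h1 ⊢
      exact h1
    have hρi : (Real.sqrt ρ2 ^ i) ^ 2 = ρ2 ^ i := by rw [← pow_mul, mul_comm, pow_mul, Real.sq_sqrt hρ20]
    have hCf1 : dirL1 (Cf i) (periodBox (d := d) (N * L ^ (k - (i + 1)))) ≤ K1' * (16 * ρ2 ^ i * β2) := by
      have e : dirL1 (Cf i) (periodBox (d := d) (N * L ^ (k - (i + 1))))
          = ∑ z ∈ periodBox (d := d) (N * L ^ (k - (i + 1))), ∑ κ : Fin d, ‖Ccov L (avgIter L W i) (logCovIter L W B i) ((L : ℤ) • z) κ‖ := rfl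
      rw [e]
      refine hC1.trans ?_
      have e2 : (4 * Real.sqrt ρ2 ^ i) ^ 2 * β2 = 16 * ρ2 ^ i * β2 := by rw [mul_pow, hρi]; norm_num
      rw [e2] at hAi2
      have := mul_le_mul_of_nonneg_left hAi2 hK1'0
      refine le_trans (le_of_eq ?_) this
      rw [hK1']; unfold l2sq; ring
    -- (b) the ℓ¹ propagation from `Ū₀^{i+1}`
    set m : ℕ := k - (i + 1) with hm
    have hprop : dirL1 (linCovIter L (avgIter L W (i + 1)) (Cf i) m) (periodBox (d := d) N)
        ≤ 2 * r ^ m * dirL1 (Cf i) (periodBox (d := d) (N * L ^ m)) := by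
      rcases Nat.eq_zero_or_pos m with hm0 | hmpos
      · rw [hm0, pow_zero, pow_zero, mul_one, Nat.mul_one, show linCovIter L (avgIter L W (i + 1)) (Cf i) 0 = Cf i from rfl]
        have := dirL1_nonneg' (Cf i) (periodBox (d := d) N)
        linarith
      · obtain ⟨m', hm'⟩ : ∃ m', m = m' + 1 := ⟨m - 1, by omega⟩
        have hi'j : i + 1 ≤ j := by omega
        obtain ⟨hW'u, hr0, hW'x⟩ := cavgIter_unitary_small hL1 i hWu hx (levelSmall_of_le (by omega) hsm) hWx
        have hsm' : LevelSmall d L m' (radIter d L (i + 1) x) := by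
          refine levelSmall_of_le (by omega) (levelSmall_radIter (i + 1) (j - (i + 1)) ?_)
          rw [Nat.add_sub_cancel' hi'j]; exact hsm
        have htw : tower L N (m' + 1) = N * L ^ (k - (i + 1)) := by rw [tower_eq_pow_mul, Nat.mul_comm, ← hm', hm]
        have hW'P : IsPeriodicCfg (cavgIter L (i + 1) W) ((tower L N (m' + 1) : ℕ) : ℤ) := by rw [htw]; exact hVP (i + 1) hik
        have hCfP' : IsPeriodicDir (Cf i) ((tower L N (m' + 1) : ℕ) : ℤ) := by rw [htw]; exact hCfP i hik
        have hloops' : ∀ i'' < m' + 1, ∀ (z : Site d) (κ : Fin d) (rr : Fin d → Fin L),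
            ‖((Wcx L (cavgIter L i'' (cavgIter L (i + 1) W)) ((L : ℤ) • z) κ (boxVec L rr) : (Matrix n n ℂ)ˣ) : Matrix n n ℂ) - 1‖ < 1 := by
          intro i'' hi'' z κ rr
          have e : cavgIter L i'' (cavgIter L (i + 1) W) = cavgIter L (i + 1 + i'') W := by
            rw [cavgIter_eq_avgIter, cavgIter_eq_avgIter, cavgIter_eq_avgIter, ← B9Eq315QTower.avgIter_add]
          rw [e]; exact hloopsW (i + 1 + i'') (by omega) z κ rr
        have hS' : (16 * (d + 1) * (d + 4) * (L : ℝ) ^ 2 * Csup d L * (d * (2 * nbRad d L + 1) ^ d)) * radSum d L m' (radIter d L (i + 1) x)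
            ≤ ((L : ℝ) / (L : ℝ) ^ d) / 2 := by
          refine le_trans (mul_le_mul_of_nonneg_left (radSum_radIter_le (d := d) (L := L) (i + 1) j m' (by omega) hx) ?_) hS1
          have := Csup_nonneg d L; positivity
        -- dictionary: `linCovIter W′ (Ad_{W′} Y′) = Ad (QbarIter W′ Y′)` with `Y′ = Ad_{W′}⁻¹ (Cf i)`
        set Y' : Site d → Fin d → Matrix n n ℂ := fun y μ => Ad ((cavgIter L (i + 1) W) y μ)⁻¹ (Cf i y μ) with hY'
        have hYY : Cf i = adField (cavgIter L (i + 1) W) Y' := (NE3.RemainderTowerPrepB8.adField_inv _ _).symm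
        have hY'P : IsPeriodicDir Y' ((tower L N (m' + 1) : ℕ) : ℤ) := by
          intro y ii μ; simp only [hY', hW'P y ii μ, hCfP' y ii μ]
        have hVm : IsUnitaryCfg (cavgIter L (m' + 1) (cavgIter L (i + 1) W)) := (cavgIter_unitary_small hL1 m' hW'u hr0 hsm' hW'x).1
        have htow := dirL1_QbarIter_le hL1 hN m' hW'u hW'P hr0 hsm' hW'x hS' hY'P
        rw [← hrdef] at htow
        have hdict' : linCovIter L (cavgIter L (i + 1) W) (adField (cavgIter L (i + 1) W) Y') (m' + 1)
            = adField (cavgIter L (m' + 1) (cavgIter L (i + 1) W)) (QbarIter L (m' + 1) (cavgIter L (i + 1) W) Y') :=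
          linCovIter_adField L _ Y' (m' + 1) hloops'
        have hgoal : dirL1 (linCovIter L (cavgIter L (i + 1) W) (Cf i) (m' + 1)) (periodBox (d := d) N)
            ≤ 2 * r ^ (m' + 1) * dirL1 (Cf i) (periodBox (d := d) (tower L N (m' + 1))) := by
          rw [hYY, hdict', dirL1_adField hVm, dirL1_adField hW'u]
          exact htow
        have htw' : tower L N (m' + 1) = N * L ^ (m' + 1) := by rw [tower_eq_pow_mul, Nat.mul_comm]
        rw [cavgIter_eq_avgIter, htw'] at hgoal
        rw [hm']
        exact hgoal
    -- (c) combine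
    have hkm : k - 1 - i = m := by omega
    calc dirL1 (linCovIter L (avgIter L W (i + 1)) (Cf i) (k - (i + 1))) (periodBox (d := d) N)
        ≤ 2 * r ^ m * dirL1 (Cf i) (periodBox (d := d) (N * L ^ m)) := hprop
      _ ≤ 2 * r ^ m * (K1' * (16 * ρ2 ^ i * β2)) := mul_le_mul_of_nonneg_left hCf1 (mul_nonneg zero_le_two (pow_nonneg hr0' m))
      _ = 32 * K1' * β2 * (r ^ m * ρ2 ^ i) := by ring
      _ = 32 * K1' * β2 * r ^ (k - 1) * (L : ℝ) ^ i := by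
          rw [hrρ, mul_pow, ← hkm]
          have e : r ^ (k - 1 - i) * (r ^ i * (L : ℝ) ^ i) = r ^ (k - 1) * (L : ℝ) ^ i := by
            rw [← mul_assoc, ← pow_add, Nat.sub_add_cancel (by omega)]
          rw [e]; ring
  -- sum over the levels
  have hVk : IsUnitaryCfg (cavgIter L k W) := by rw [hk]; exact (cavgIter_unitary_small hL1 j hWu hx hsm hWx).1
  have hdict : linCovIter L W B k = adField (cavgIter L k W) (QbarIter L k W Z) := linCovIter_adField L W Z k hloopsW
  have hgeo := geom_sum_L_le hLR k
  calc dirL1 (QbarIter L k W Z) (periodBox (d := d) N)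
      = dirL1 (linCovIter L W B k) (periodBox (d := d) N) := by rw [hdict, dirL1_adField hVk]
    _ = dirL1 (∑ i ∈ Finset.range k, linCovIter L (avgIter L W (i + 1)) (Cf i) (k - (i + 1))) (periodBox (d := d) N) := by
        rw [hlin, dirL1_neg]
    _ ≤ ∑ i ∈ Finset.range k, dirL1 (linCovIter L (avgIter L W (i + 1)) (Cf i) (k - (i + 1))) (periodBox (d := d) N) :=
        dirL1_finset_sum_le _ _ _
    _ ≤ ∑ i ∈ Finset.range k, 32 * K1' * β2 * r ^ (k - 1) * (L : ℝ) ^ i := Finset.sum_le_sum hterm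
    _ = 32 * K1' * β2 * r ^ (k - 1) * ∑ i ∈ Finset.range k, (L : ℝ) ^ i := by rw [Finset.mul_sum]
    _ ≤ 32 * K1' * β2 * r ^ (k - 1) * (2 * (L : ℝ) ^ (k - 1)) :=
        mul_le_mul_of_nonneg_left hgeo (mul_nonneg (mul_nonneg (mul_nonneg (by norm_num) hK1'0) hβ20) (pow_nonneg hr0' _))
    _ = 64 * K1' * (r * L) ^ (k - 1) * β2 := by rw [mul_pow]; ring
    _ = 64 * (C1cov d * (L : ℝ) ^ 2 * (d * (2 * (2 * (L : ℝ)) + 1) ^ d)) * (((L : ℝ) / (L : ℝ) ^ d) * L) ^ (j + 1 - 1)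
          * l2sq (periodBox (d := d) (N * L ^ (j + 1))) Z := by rw [hK1', hrdef, hβ2, hk]

end

end Summit.QuantumFields.BalabanUV.T4Continuum.NE3.RemainderL1FinalB8
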